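import Summits.SmoothPoincare4.SmoothPoincare4.Theorems.ConvexBisectionAcyclicBisectionExistsChartedChainCycle
import Summits.SmoothPoincare4.SmoothPoincare4.Theorems.ConvexBisectionAcyclicBisectionExistsChartedChainChordSign
import Summits.SmoothPoincare4.SmoothPoincare4.Theorems.ConvexBisectionAcyclicBisectionExistsPicardLefschetzChart
import HarnessLib

/-!
# Exclusion principles for the closed collar of the charted vanishing cycle
(wave 4, brick Y4-4 (tools) of the model chain (R2) `exists_charted_chain` for the missing lemma
`crossingNumber_eq_stdSymp` of node N1a of stub `stub_modelsOnFibred_of_reach` = NF4, line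
`modp-braid-orbits`, crux `ConvexBisection.AcyclicBisectionExists`, item stmt-SmoothPoincare4-10508;
registered sub-goal `helper_not_mem_image_of_upper`)

How to certify that a point `q` of `page g c` is OFF the closed collar
`cycleChart (ℝ × [−1/2, 1/2])` of the annulus chart of the vanishing cycle over the symmetric chord
(`t = radP r · e^{2πiu}`, `radP (1/2) ≤ ‖t‖ ≤ radP (−1/2)` there, `collar_point`):

* (X1) `not_mem_collar_of_norm_lt` — the `x`-coordinate of `q` is `λ · jX t₀` with
  `1 ≤ ‖t₀‖ < radP (1/2)` (Joukowski injectivity gives `t ∈ {t₀, t₀⁻¹}`; compare norms);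
* (X2) `helper_not_mem_image_of_upper` — `q` is an UPPER-sheet point `(λ jX (iρ'), +μ √(…))` over
  the real axis (then `t = iρ'`, but `jY (iρ') = −√(…)` is the lower sheet): not in the image of the
  chart at all;
* (X3) `not_mem_collar_of_re_le` — `Re` of the `x`-coordinate is `≤ Re jX (i radP (−3/4))`
  (`Re jX t ≥ m − σ (‖t‖ − ‖t‖⁻¹)/2` and `ρ ↦ ρ − ρ⁻¹` increasing); e.g. the straight segments to
  `ζ_1` or `ζ_{2g−1}` (`re_branchPt_one_le`);
* (X4) `not_mem_collar_of_height` — `q = cycleChart (u₀, r₀)` with `|r₀| > 1/2` (chart injectivity).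

Everything is proved; no `sorry`.  References: B. Farb, D. Margalit, *A primer on mapping class
groups* (2012), §6.1 [FarbMargalit2012].
-/

noncomputable section

set_option linter.dupNamespace false

open scoped Manifold ContDiff Topology ComplexConjugate Real
open Set Function Metric Complex
open Literature.Topology.FourManifolds Literature.Topology.FourManifolds.LefschetzBase

namespace Summit.SmoothPoincare4.SmoothPoincare4.Theorems.AcyclicBisectionExists.ModpBraidOrbits

variable {g : ℕ} {c : ℂ}

/-! ## §1 The exclusion principles -/

/-- `radP (1/2) ≤ radP r ≤ radP (−1/2)` for `|r| ≤ 1/2`. [folklore] -/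
theorem radP_mem_of_abs_le {r : ℝ} (hr : r ∈ Icc (-(1 / 2) : ℝ) (1 / 2)) :
    radP g (1 / 2) ≤ radP g r ∧ radP g r ≤ radP g (-(1 / 2)) := by
  have hr' : r ∈ Icc (-1 : ℝ) 1 := ⟨by linarith [hr.1], by linarith [hr.2]⟩
  exact ⟨(strictAntiOn_radP g).antitoneOn hr' ⟨by norm_num, by norm_num⟩ hr.2,
    (strictAntiOn_radP g).antitoneOn ⟨by norm_num, by norm_num⟩ hr' hr.1⟩

/-- A chart point with `|r| ≤ 1/2`, unfolded: its `x`-coordinate is `λ · jX t` with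
`t = tParam (u, r)`, `radP (1/2) ≤ ‖t‖ ≤ radP (−1/2)`. [folklore] -/
theorem collar_point (hg : 1 ≤ g) (hc : ‖c‖ ≤ 1) {q : Base g}
    (hq : q ∈ cycleChart hg hc '' (univ ×ˢ Icc (-(1 / 2) : ℝ) (1 / 2))) :
    ∃ p : ℝ × ℝ, p.2 ∈ Icc (-(1 / 2) : ℝ) (1 / 2) ∧ cycleChart hg hc p = q ∧
      cx q.1 = scaleX g c * jX g (tParam g p) ∧ radP g (1 / 2) ≤ ‖tParam g p‖ ∧ ‖tParam g p‖ ≤ radP g (-(1 / 2)) := by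
  obtain ⟨p, ⟨-, hp⟩, rfl⟩ := hq
  refine ⟨p, hp, rfl, by simp [cycleAmb], ?_, ?_⟩ <;> rw [norm_tParam]
  · exact (radP_mem_of_abs_le hp).1
  · exact (radP_mem_of_abs_le hp).2

/-- **(X1)** A point whose `x`-coordinate is `λ · jX t₀` with `1 ≤ ‖t₀‖ < radP (1/2)` is off the
closed collar. [folklore] -/
theorem not_mem_collar_of_norm_lt (hg : 1 ≤ g) (hc : ‖c‖ ≤ 1) {q : Base g} {t₀ : ℂ}
    (hx : cx q.1 = scaleX g c * jX g t₀) (h1 : 1 ≤ ‖t₀‖) (h2 : ‖t₀‖ < radP g (1 / 2)) :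
    q ∉ cycleChart hg hc '' (univ ×ˢ Icc (-(1 / 2) : ℝ) (1 / 2)) := fun hq => by
  obtain ⟨p, -, -, hx', hlo, -⟩ := collar_point hg hc hq
  rw [hx] at hx'
  have ht₀ : t₀ ≠ 0 := by rw [← norm_pos_iff]; linarith
  have e := mul_left_cancel₀ (scaleX_ne_zero hc) hx'
  rcases (jX_eq_jX_iff hg ht₀ (tParam_ne_zero g p)).1 e with e | e
  · rw [e] at h2; linarith
  · have : ‖t₀‖ = ‖tParam g p‖⁻¹ := by rw [e, norm_inv]
    have h3 : ‖tParam g p‖⁻¹ < 1 := inv_lt_one_of_one_lt₀ (one_lt_norm_tParam g p)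
    linarith

/-- **(X2)** An UPPER-sheet point over the real axis, `pagePt g c (jX (iρ'), +√(…))` with
`1 ≤ ρ' ≤ 1 + 1/(2g+1)`, is not in the image of the chart at all. [folklore] -/
theorem not_mem_image_of_upper (hg : 1 ≤ g) (hc : ‖c‖ ≤ 1) {q : Base g} {ρ' : ℝ} (h1 : 1 ≤ ρ')
    (h2 : ρ' ≤ 1 + 1 / (2 * g + 1))
    (hq : q.1 = pagePt g c (jX g (I * ρ')) (csqrt (jX g (I * ρ') ^ (2 * g + 1) + 1))) (p : ℝ × ℝ) :
    cycleChart hg hc p ≠ q := fun h => by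
  have h' := congrArg (fun z : Base g => z.1) h
  simp only [cycleChart_val, cycleAmb, hq] at h'
  obtain ⟨hx, hy⟩ := (pagePt_inj hc).1 h'
  have hI : I * (ρ' : ℂ) ≠ 0 := mul_ne_zero I_ne_zero (by exact_mod_cast (show ρ' ≠ 0 by linarith))
  have hnI : ‖I * (ρ' : ℂ)‖ = ρ' := by
    rw [norm_mul, Complex.norm_I, one_mul, Complex.norm_real, Real.norm_eq_abs, abs_of_pos (by linarith)]
  rcases (jX_eq_jX_iff hg (tParam_ne_zero g p) hI).1 hx with e | e
  · rw [e, jY_I_mul_eq_neg_csqrt hg h1 h2] at hy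
    have h0 : csqrt (jX g (I * ρ') ^ (2 * g + 1) + 1) = 0 := by
      have : (2 : ℂ) * csqrt (jX g (I * ρ') ^ (2 * g + 1) + 1) = 0 := by linear_combination -hy
      simpa using this
    have hf : jX g (I * ρ') ^ (2 * g + 1) + 1 = 0 := by rw [← csqrt_sq (jX g (I * ρ') ^ (2 * g + 1) + 1), h0]; ring
    rw [jX_I_mul] at hf
    have hξ : 0 < cmid g - shalf g * ((ρ' - ρ'⁻¹) / 2) := by
      have hm := half_le_cmid hg
      have hs1 : shalf g ≤ 1 := Real.sin_le_one _
      have hb : (ρ' - ρ'⁻¹) / 2 ≤ 1 / 3 := by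
        have hρ : (0 : ℝ) < ρ' := by linarith
        have key : (ρ' - ρ'⁻¹) / 2 - (ρ' - 1) = -((ρ' - 1) ^ 2) / (2 * ρ') := by field_simp; ring
        have hk : -((ρ' - 1) ^ 2) / (2 * ρ') ≤ 0 :=
          div_nonpos_of_nonpos_of_nonneg (neg_nonpos.2 (sq_nonneg _)) (by linarith)
        have hg1 : (1 : ℝ) / (2 * g + 1) ≤ 1 / 3 := by
          apply one_div_le_one_div_of_le (by norm_num)
          have : (1 : ℝ) ≤ g := by exact_mod_cast hg
          linarith
        linarith
      nlinarith [shalf_pos hg]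
    have : (0 : ℝ) < (cmid g - shalf g * ((ρ' - ρ'⁻¹) / 2)) ^ (2 * g + 1) + 1 := by positivity
    have hf' : ((cmid g - shalf g * ((ρ' - ρ'⁻¹) / 2)) ^ (2 * g + 1) + 1 : ℝ) = 0 := by exact_mod_cast hf
    linarith
  · have := one_lt_norm_tParam g p
    rw [e, norm_inv, hnI] at this
    have : ρ'⁻¹ ≤ 1 := inv_le_one_of_one_le₀ h1
    linarith

/-- `Re jX t ≥ m − σ (‖t‖ − ‖t‖⁻¹)/2` for `‖t‖ ≥ 1`. [folklore] -/
theorem re_jX_ge_b (hg : 1 ≤ g) {t : ℂ} (ht : 1 ≤ ‖t‖) :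
    cmid g - shalf g * ((‖t‖ - ‖t‖⁻¹) / 2) ≤ (jX g t).re := by
  rw [jX_re]
  have h0 : 0 < ‖t‖ := by linarith
  have h1 : 0 ≤ 1 - (‖t‖ ^ 2)⁻¹ := by rw [sub_nonneg]; exact inv_le_one_of_one_le₀ (by nlinarith)
  have h2 : t.im ≤ ‖t‖ := (le_abs_self _).trans (Complex.abs_im_le_norm t)
  have h3 : t.im * (1 - (‖t‖ ^ 2)⁻¹) ≤ ‖t‖ * (1 - (‖t‖ ^ 2)⁻¹) := mul_le_mul_of_nonneg_right h2 h1
  have h4 : ‖t‖ * (1 - (‖t‖ ^ 2)⁻¹) = ‖t‖ - ‖t‖⁻¹ := by field_simp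
  nlinarith [shalf_pos hg]

/-- `ρ ↦ ρ − ρ⁻¹` is strictly increasing on `(0, ∞)`. [folklore] -/
theorem sub_inv_lt_sub_inv {a b : ℝ} (ha : 0 < a) (hab : a < b) : a - a⁻¹ < b - b⁻¹ := by
  have : b⁻¹ < a⁻¹ := inv_strictAnti₀ ha hab
  linarith

/-- **(X3)** A point whose `x`-coordinate has real part `≤ Re jX (i · radP (−3/4))` is off the
closed collar. [folklore] -/
theorem not_mem_collar_of_re_le (hg : 1 ≤ g) (hc : ‖c‖ ≤ 1) {q : Base g} {x : ℂ}
    (hx : cx q.1 = scaleX g c * x) (hre : x.re ≤ (jX g (I * radP g (-(3 / 4)))).re) :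
    q ∉ cycleChart hg hc '' (univ ×ˢ Icc (-(1 / 2) : ℝ) (1 / 2)) := fun hq => by
  obtain ⟨p, -, -, hx', -, hhi⟩ := collar_point hg hc hq
  rw [hx] at hx'
  have e := mul_left_cancel₀ (scaleX_ne_zero hc) hx'
  have h1 := re_jX_ge_b hg (one_lt_norm_tParam g p).le
  rw [← e] at h1
  rw [jX_I_mul, Complex.ofReal_re] at hre
  have hlt : radP g (-(1 / 2)) < radP g (-(3 / 4)) :=
    strictAntiOn_radP g ⟨by norm_num, by norm_num⟩ ⟨by norm_num, by norm_num⟩ (by norm_num)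
  have h2 := sub_inv_lt_sub_inv (by linarith [one_lt_norm_tParam g p]) (lt_of_le_of_lt hhi hlt)
  nlinarith [shalf_pos hg]

/-- **(X4)** A chart point of height `r₀ ∈ (−1, 1)`, `|r₀| > 1/2`, is off the closed collar.
[folklore] -/
theorem not_mem_collar_of_height (hg : 1 ≤ g) (hc : ‖c‖ ≤ 1) {u₀ r₀ : ℝ} (hr₀ : r₀ ∈ Ioo (-1 : ℝ) 1)
    (hfar : 1 / 2 < |r₀|) :
    cycleChart hg hc (u₀, r₀) ∉ cycleChart hg hc '' (univ ×ˢ Icc (-(1 / 2) : ℝ) (1 / 2)) := by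
  rintro ⟨p, ⟨-, hp⟩, h⟩
  have e := (chart_eq_iff (cycleChart_periodic hg hc) (cycleChart_injOn hg hc)
    (p := p) (p' := (u₀, r₀)) ⟨by linarith [hp.1], by linarith [hp.2]⟩ hr₀ h).1
  have e' : p.2 = r₀ := e
  have : |r₀| ≤ 1 / 2 := by rw [← e']; exact abs_le.2 ⟨hp.1, hp.2⟩
  linarith

/-! ## §2 The straight segments to the neighbouring branch points -/

/-- `Re ζ_1 ≤ Re jX (i · radP (−3/4))` (`cos θ_1 ≤ m − 2σ²` and `σ b ≤ σ/(4(2g+1)) < 2σ²`).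
[folklore] -/
theorem re_branchPt_one_le (hg : 1 ≤ g) : (branchPt g 1).re ≤ (jX g (I * radP g (-(3 / 4)))).re := by
  rw [branchPt, Complex.exp_ofReal_mul_I_re, jX_I_mul, Complex.ofReal_re]
  have h1 := cos_branchAngle_one_le hg
  have h2 := two_div_le_shalf hg
  have h3 := radP_le g (-(3 / 4))
  have h4 := one_lt_radP g (-(3 / 4))
  have hb : (radP g (-(3 / 4)) - (radP g (-(3 / 4)))⁻¹) / 2 ≤ radP g (-(3 / 4)) - 1 := by
    have : (radP g (-(3 / 4)))⁻¹ * radP g (-(3 / 4)) = 1 := inv_mul_cancel₀ (by linarith)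
    nlinarith [inv_pos.2 (by linarith : (0 : ℝ) < radP g (-(3 / 4)))]
  have h0 : (0 : ℝ) < 2 * g + 1 := by positivity
  have h5 : 1 / (4 * (2 * (g : ℝ) + 1)) ≤ shalf g / 8 := by
    rw [div_le_div_iff₀ (by positivity) (by norm_num)]
    have := (div_le_iff₀ h0).1 h2
    nlinarith
  nlinarith [shalf_pos hg]

/-- `Re ζ_{2g−1} = Re ζ_1 ≤ Re jX (i · radP (−3/4))`. [folklore] -/
theorem re_branchPt_pred_le (hg : 1 ≤ g) : (branchPt g (2 * g - 1)).re ≤ (jX g (I * radP g (-(3 / 4)))).re := by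
  rw [branchPt_two_mul_sub (by omega : 1 ≤ 2 * g), Complex.conj_re]
  exact re_branchPt_one_le hg

/-- **Sub-goal `helper_not_mem_image_of_upper`** (exclusion (X2), a tool of the model chain (R2) for
node N1a of NF4): an upper-sheet point over the real axis of the `x`-plane, `(λ jX (iρ'), +μ √(…))`
with `1 ≤ ρ' ≤ 1 + 1/(2g+1)`, is not in the image of the annulus chart `cycleChart`.
[cite: FarbMargalit2012, §6.1] -/
theorem helper_not_mem_image_of_upper : ∀ (g : ℕ) (c : ℂ) (hg : 1 ≤ g) (hc : ‖c‖ ≤ 1) (q : Literature.Topology.FourManifolds.LefschetzBase.Base g) (ρ' : ℝ), 1 ≤ ρ' → ρ' ≤ 1 + 1 / (2 * g + 1) → q.1 = Summit.SmoothPoincare4.SmoothPoincare4.Theorems.AcyclicBisectionExists.ModpBraidOrbits.pagePt g c (Summit.SmoothPoincare4.SmoothPoincare4.Theorems.AcyclicBisectionExists.ModpBraidOrbits.jX g (Complex.I * ρ')) (Literature.Topology.FourManifolds.LefschetzBase.csqrt (Summit.SmoothPoincare4.SmoothPoincare4.Theorems.AcyclicBisectionExists.ModpBraidOrbits.jX g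 (Complex.I * ρ') ^ (2 * g + 1) + 1)) → ∀ p : ℝ × ℝ, Summit.SmoothPoincare4.SmoothPoincare4.Theorems.AcyclicBisectionExists.ModpBraidOrbits.cycleChart hg hc p ≠ q :=
  fun _ _ hg hc _ _ h1 h2 hq p => not_mem_image_of_upper hg hc h1 h2 hq p

end Summit.SmoothPoincare4.SmoothPoincare4.Theorems.AcyclicBisectionExists.ModpBraidOrbits

end
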